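import Summits.KontsevichZagierPeriods.KontsevichZagierPeriods.Theses.FurushoPentagon

/-!
# Sketch — crux `FurushoPentagon.SectorToKernel` (stmt-KontsevichZagierPeriods-10813), ideator 3, round 1

First lemmas of the two crux idea cards (they must elaborate; both are in fact PROVED here).

* Card `cube-compilation-pi-local-bridge`: `piLocalKernel_of_cubical` and `sectorToKernel_of_piLocal`.
* Card `fraction-field-genericity`: `kernel_iff_isDomain_and_genericEval` and
  `sectorToKernel_of_isDomain_of_genericEval`.
-/

noncomputable section

namespace Summit.KontsevichZagierPeriods.KontsevichZagierPeriods.Cruxes.SectorToKernel.SketchIdeator3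

open Literature.NumberTheory.Transcendental Literature.NumberTheory.Transcendental.KZ
open Summit.KontsevichZagierPeriods.KontsevichZagierPeriods.Theses.FurushoPentagon
open Set

/-! ## Vocabulary (VERBATIM copy of `Theorems/FurushoPentagonReducedPeriodRingDefs.lean`, namespace
`Summit.KontsevichZagierPeriods.FurushoPentagon.ReducedPeriodRing`, so that this sketch does not
depend on that module being built on the farm; the skeleton stage imports the Theorems file instead) -/

/-- The closed unit cube `[0,1]ⁿ`. -/
def unitCube (n : ℕ) : Set (Fin n → ℝ) := {x | ∀ i, 0 ≤ x i ∧ x i ≤ 1}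

/-- Tame cube classes: `[r]` with `r.domain = [0,1]ⁿ` and integrand real analytic near the cube. -/
def cubicalGens : Set FormalRep :=
  {d | ∃ (n : ℕ) (r : IntegralRep n),
    r.domain = unitCube n ∧ AnalyticOnNhd ℝ r.integrand (unitCube n) ∧ d = of r}

/-- The subgroup of `KZ.FormalRep` generated by the tame cube classes. -/
def cubicalSpan : AddSubgroup FormalRep := AddSubgroup.closure cubicalGens

/-! ## Card 1: cube compilation + Ayoub's Conjecture 7 read on the cubical span -/

/-- K1 (rules-side, transcendence-free; = stubs S1b `stub_cubeResolution` (+ S1a) of line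
`effective-end-monoid` of the sibling crux `ReducedPeriodRing`, extended additively): every formal
combination is, modulo the KZ relations, a `ℤ`-combination of tame cube classes. -/
def CubeNormalForm : Prop := ∀ c : FormalRep, ∃ a ∈ cubicalSpan, c - a ∈ relations

/-- Conjecture leaf transcribed to the rules (⟸ Ayoub 2014 Conj. 7 in the form of Rem. 13 via the map
Θ : real cube generator ↦ tame cube class, which sends each Stokes relation ∂ᵢf − f|₁ + f|₀ to two moves):
`PiLocalKernel` restricted to the cubical span. -/
def CubicalPiLocalKernel : Prop :=
  ∀ a ∈ cubicalSpan, eval a = 0 → ∃ N : ℕ, (fun x => of piRep * x)^[N] a ∈ relations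

/-- Per-representation cube resolution (verbatim shape of `stub_cubeResolution`) gives `CubeNormalForm`. -/
theorem cubeNormalForm_of_resolution
    (h : ∀ (N : ℕ) (u : IntegralRep N), ∃ c : FormalRep, c ∈ cubicalSpan ∧ of u - c ∈ relations) :
    CubeNormalForm := by
  intro c
  induction c using FreeAbelianGroup.induction_on with
  | zero => exact ⟨0, cubicalSpan.zero_mem, by simpa using relations.zero_mem⟩
  | of x =>
    obtain ⟨n, u⟩ := x
    obtain ⟨a, ha, hua⟩ := h n u
    exact ⟨a, ha, hua⟩
  | neg x ih =>
    obtain ⟨a, ha, hxa⟩ := ih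
    refine ⟨-a, cubicalSpan.neg_mem ha, ?_⟩
    have : -FreeAbelianGroup.of x - -a = -(FreeAbelianGroup.of x - a) := by abel
    rw [this]
    exact relations.neg_mem hxa
  | add x y hx hy =>
    obtain ⟨a, ha, hxa⟩ := hx
    obtain ⟨b, hb, hyb⟩ := hy
    refine ⟨a + b, cubicalSpan.add_mem ha hb, ?_⟩
    have : x + y - (a + b) = (x - a) + (y - b) := by abel
    rw [this]
    exact relations.add_mem hxa hyb

/-- **First lemma of card 1 (the bridge, proved).** Cube compilation + Conj. 7 on cubes ⇒ the
`π`-local kernel property of route AyoubSpecialisation, with NO Nori symbol map and NO hand transfer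
of cohomological relators. -/
theorem piLocalKernel_of_cubical (hNF : CubeNormalForm) (hC : CubicalPiLocalKernel) :
    PiLocalKernel := by
  intro c hc
  obtain ⟨a, ha, hca⟩ := hNF c
  have h0 : eval (c - a) = 0 := relations_le_ker_eval_holds hca
  have hea : eval a = 0 := by
    rw [map_sub, hc, zero_sub, neg_eq_zero] at h0
    exact h0
  obtain ⟨N, hN⟩ := hC a ha hea
  refine ⟨N, ?_⟩
  have hlin : ∀ (M : ℕ) (x y : FormalRep),
      (fun x => of piRep * x)^[M] (x - y) =
        (fun x => of piRep * x)^[M] x - (fun x => of piRep * x)^[M] y := by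
    intro M
    induction M with
    | zero => intro x y; rfl
    | succ M ih => intro x y; simp only [Function.iterate_succ_apply', ih, mul_sub]
  have h1 : (fun x => of piRep * x)^[N] (c - a) ∈ relations := piRep_mul_iterate_mem_relations N hca
  rw [hlin] at h1
  have : (fun x => of piRep * x)^[N] c =
      ((fun x => of piRep * x)^[N] c - (fun x => of piRep * x)^[N] a) +
        (fun x => of piRep * x)^[N] a := by abel
  rw [this]
  exact relations.add_mem h1 hN

/-- Card 1, composition with the tree's π-localisation assembly: the crux follows from
`PiLocalKernel ∧ PiCancellation` (the antecedents StuffleInKZ / HoffmanRelationInKZ are not used). -/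
theorem sectorToKernel_of_piLocal (h1 : PiLocalKernel) (h2 : PiCancellation) : SectorToKernel := by
  -- same 6-line induction as `Theorems/AyoubSpecialisationAssembly.lean`
  -- (`kzKernelConjecture_of_piLocalKernel_of_piCancellation`), inlined to keep the import cone minimal
  intro _ _ c hc
  obtain ⟨N, hN⟩ := h1 c hc
  clear hc
  induction N generalizing c with
  | zero => simpa using hN
  | succ N ih =>
    exact h2 c (ih (of piRep * c) (by simpa [Function.iterate_succ_apply] using hN))

/-- Card 1, full chain. -/
theorem sectorToKernel_of_cubical (hNF : CubeNormalForm) (hC : CubicalPiLocalKernel)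
    (h2 : PiCancellation) : SectorToKernel :=
  sectorToKernel_of_piLocal (piLocalKernel_of_cubical hNF hC) h2

/-- The first UNCONDITIONAL rung of card 1 (dimension one): vanishing `ℤ`-combinations of one-variable
tame cube classes `∫₀¹ f` (f algebraic, analytic near `[0,1]`) are killed in `KZ.relations` by a power
of the disc. Provable from named facts: Huber–Wüstholz 2022 Thm 13.3 (period conjecture for 1-periods)
+ Ayoub 2014 Prop. 11 (localised compact presentation) + the two-move calculus of Θ + Machin calibration. -/
def CubicalPiLocalKernelDimOne : Prop :=
  ∀ a ∈ AddSubgroup.closure {d : FormalRep | ∃ r : IntegralRep 1,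
      r.domain = unitCube 1 ∧ AnalyticOnNhd ℝ r.integrand (unitCube 1) ∧ d = of r},
    eval a = 0 → ∃ N : ℕ, (fun x => of piRep * x)^[N] a ∈ relations

/-- The rung is the dimension-one case of the leaf. -/
theorem dimOne_of_cubicalPiLocalKernel (hC : CubicalPiLocalKernel) : CubicalPiLocalKernelDimOne := by
  intro a ha h0
  refine hC a ?_ h0
  refine AddSubgroup.closure_mono ?_ ha
  rintro d ⟨r, hr, hra, rfl⟩
  exact ⟨1, r, hr, hra, rfl⟩

/-- Converse bookkeeping (exactness of the decomposition): the kernel form implies each conjunct. -/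
theorem cubicalPiLocalKernel_of_kernel (hK : ∀ c : FormalRep, eval c = 0 → c ∈ relations) :
    CubicalPiLocalKernel := fun a _ ha => ⟨0, hK a ha⟩

/-! ## Card 2: fraction-field form — `Kernel ⟺ IsDomain ∧ GenericEval` -/

/-- The rules ring `FormalRep ⧸ relations` has no zero-divisors. Transcendence-free; upgrades the
route's crux `ReducedPeriodRing` (no nilpotents). -/
def IsDomainModRel : Prop :=
  ∀ x y : FormalRep, x * y ∈ relations → x ∈ relations ∨ y ∈ relations

/-- Genericity of evaluation, rules-internal (Grothendieck's conjecture in generic-point form, Ayoub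
2014 Cor. 28, transcribed): a numerically vanishing combination is derivable OR a zero-divisor modulo
the relations. Equivalently: evaluation extends to the total ring of fractions. -/
def GenericEval : Prop :=
  ∀ x : FormalRep, eval x = 0 → x ∈ relations ∨ ∃ y : FormalRep, y ∉ relations ∧ x * y ∈ relations

/-- **First lemma of card 2 (proved): exact internal form of Ayoub's Cor. 32 for the rules ring.**
"A ring hom out of a field is injective." -/
theorem kernel_iff_isDomain_and_genericEval :
    (∀ c : FormalRep, eval c = 0 → c ∈ relations) ↔ (IsDomainModRel ∧ GenericEval) := by
  constructor
  · intro hK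
    refine ⟨fun x y hxy => ?_, fun x hx => Or.inl (hK x hx)⟩
    have h0 : eval (x * y) = 0 := relations_le_ker_eval_holds hxy
    rw [eval_mul'] at h0
    rcases mul_eq_zero.mp h0 with h | h
    · exact Or.inl (hK x h)
    · exact Or.inr (hK y h)
  · rintro ⟨hD, hG⟩ c hc
    rcases hG c hc with h | ⟨y, hy, hcy⟩
    · exact h
    · rcases hD c y hcy with h | h
      · exact h
      · exact absurd h hy

/-- Card 2, composition: the crux from the two conjuncts (antecedents unused). -/
theorem sectorToKernel_of_isDomain_of_genericEval (hD : IsDomainModRel) (hG : GenericEval) :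
    SectorToKernel :=
  fun _ _ => kernel_iff_isDomain_and_genericEval.2 ⟨hD, hG⟩

/-- Card 2 subsumes the route's crux 3: a domain has no nilpotents. -/
theorem reducedPeriodRing_of_isDomain (hD : IsDomainModRel) : ReducedPeriodRing :=
  fun c hc => (hD c c hc).elim id id

/-- Card 2 also subsumes route AyoubSpecialisation's crux `PiCancellation` (item 0540): `[π]` is not a
relation (its value is `π ≠ 0`, soundness), so in a domain it cancels. -/
theorem piCancellation_of_isDomain (hD : IsDomainModRel) : PiCancellation := by
  intro c hc
  rcases hD (of piRep) c hc with h | h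
  · exfalso
    have h0 : eval (of piRep) = 0 := relations_le_ker_eval_holds h
    rw [eval_of, piRep_value] at h0
    exact Real.pi_ne_zero h0
  · exact h

/-- Integrality AFTER inverting `[π]`: a product relation forces one factor to be `[π]`-power
torsion modulo the relations. Motivic shadow (granting the localised comparison): connectedness of
the period torsor, i.e. of the motivic Galois group of `ℚ̄` — the NON-transcendental clause of
Grothendieck's conjecture (HMS Conj. 13.2.5: GPC(M) ⟺ X(M) connected ∧ trdeg = dim). -/
def IsDomainLocalised : Prop :=
  ∀ x y : FormalRep, x * y ∈ relations →
    (∃ N : ℕ, (fun z => of piRep * z)^[N] x ∈ relations) ∨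
    (∃ N : ℕ, (fun z => of piRep * z)^[N] y ∈ relations)

/-- Peeling powers of `[π]` with `PiCancellation`. -/
theorem mem_relations_of_iterate (h2 : PiCancellation) :
    ∀ (N : ℕ) (x : FormalRep), (fun z => of piRep * z)^[N] x ∈ relations → x ∈ relations := by
  intro N
  induction N with
  | zero => intro x hx; simpa using hx
  | succ N ih =>
    intro x hx
    exact h2 x (ih (of piRep * x) (by simpa [Function.iterate_succ_apply] using hx))

/-- **Second exact cut (proved): `IsDomain ⟺ PiCancellation ∧ IsDomainLocalised`.** So the crux is
literally `PiCancellation ∧ IsDomainLocalised ∧ GenericEval`: the effective/localised seam (0540),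
the connectedness clause and the generic-point clause of Grothendieck's conjecture, each as a
rules statement. -/
theorem isDomain_iff_piCancellation_and_localised :
    IsDomainModRel ↔ (PiCancellation ∧ IsDomainLocalised) := by
  constructor
  · intro hD
    exact ⟨piCancellation_of_isDomain hD, fun x y hxy => (hD x y hxy).imp (fun h => ⟨0, h⟩) (fun h => ⟨0, h⟩)⟩
  · rintro ⟨h2, hL⟩ x y hxy
    rcases hL x y hxy with ⟨N, hN⟩ | ⟨N, hN⟩
    · exact Or.inl (mem_relations_of_iterate h2 N x hN)
    · exact Or.inr (mem_relations_of_iterate h2 N y hN)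

/-- The three-way cut of the crux. -/
theorem sectorToKernel_of_threeWayCut (h2 : PiCancellation) (hL : IsDomainLocalised)
    (hG : GenericEval) : SectorToKernel :=
  sectorToKernel_of_isDomain_of_genericEval
    (isDomain_iff_piCancellation_and_localised.2 ⟨h2, hL⟩) hG

/-- `GenericEval` in "extension" form: every non-derivable non-zero-divisor has non-zero value. -/
theorem genericEval_iff :
    GenericEval ↔ ∀ x : FormalRep, x ∉ relations →
      (∀ y : FormalRep, x * y ∈ relations → y ∈ relations) → eval x ≠ 0 := by
  constructor
  · intro hG x hx hreg h0
    rcases hG x h0 with h | ⟨y, hy, hxy⟩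
    · exact hx h
    · exact hy (hreg y hxy)
  · intro h x hx
    by_contra hcon
    push Not at hcon
    exact h x hcon.1 (fun y hxy => by_contra fun hy => (hcon.2 y hy) hxy) hx

end Summit.KontsevichZagierPeriods.KontsevichZagierPeriods.Cruxes.SectorToKernel.SketchIdeator3
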